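import Mathlib
import HarnessLib
import Summits.HubbardSuperconductivity.HubbardSuperconductivity.Theorems.KLProgrammeKLRegimeSplitEdgeFactsRungSecondDiff

/-!
# Route `KLProgramme` — ENGINE (stmt-HubbardSuperconductivity-20437 `KLRegimeEngineV17F2`), row (c), binder #9: FIRST BRICKS of cure (C′)
# «LOCALISED SELF-ENERGY» of the located item #22 «(c)-OUT-NEAR-SLICE-LEGS» — MATSUBARA ODDNESS of the frame rung
# (cell gate-hubbard-kl, seat hubbard-kl-k3c2-p2 g30, technique «thermal-bar induction n ≤ nScales β + 1 with EngineBoundsAtV4S sums»; pen (R595)/(R596) choice (i))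

WHY.  Located #22 sub-row (C): the born row of binder #9 treats the self-energy line `Y = V6·Sg` as a generic bounded Lipschitz function and so
cannot see that the LEADING part of the self-energy on the slice is the LOCALISED linear form `z_S·(iω − e_K)` (wave-function / velocity
renormalisation), which is ODD against the EVEN slice kernels.  This file records the two exact identities that make the localised born sum
collapse, and the frequency-parity reduction that turns it into an odd momentum sum (the DOS-slope structure of located #21's constant `c_T`):

* `klod_propCT_mul_lin` — `ĝ_K(p)·(iω_p − e_K(p)) = −1`: a rung times the localised linear form is a constant, so in the born kernel
  `Ẇ(p)Φ_j(p)·ĝ(p)²·z_S(iω_p − e_K(p)) = −z_S·Ẇ(p)Φ_j(p)·ĝ(p)` (`klod_propCT_sq_mul_lin`);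
* `klod_propCT_rev` / `klod_propCT_add_rev` — the rung at the reversed Matsubara label is the complex conjugate, `ĝ(ν) + ĝ(ν̄) = 2e_K/(ω_ν² + e_K²)`;
* **`klod_sum_even_mul_propCT`** — for every EVEN real frequency weight `a(ν̄) = a(ν)` (all cutoff / slice / soft symbols of the tree are functions of
  `ω² + e_K²`): `Σ_ν a(ν)·ĝ_K(ν,k) = e_K(k)·Σ_ν a(ν)/(ω_ν² + e_K(k)²)` — REAL, and ODD in `e_K(k)` whenever `a` depends on `k` through `e_K(k)²` only;
  with a nonnegative weight the sum has the SIGN of `e_K(k)` (`klod_sum_even_mul_propCT_re_mul_xi_nonneg`), so the momentum sum over a slice shell is a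
  two-sided shell-count ASYMMETRY sum (next brick: odd momentum sums vs. the asymmetry; then the DOS-slope count).
* `klod_sum_even_mul_propCT_sq_mul_lin` — the born-localised corollary: `Σ_ν a(ν)·ĝ(ν,k)²·(iω_ν − e_K(k)) = −e_K(k)·Σ_ν a(ν)/(ω_ν² + e_K(k)²)`.
Pure identities about the frame rung `propCT` (finite sums, `β ≠ 0`); nothing about the model's sizes; nothing asserts (c), K3 or superconductivity.
References: BGM 2006 §2.9 (wave-function renormalisation; the localisation `ℒ` on the two-leg kernel) [cite: BenfattoGiulianiMastropietro2006].
-/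

noncomputable section

namespace Summit.HubbardSuperconductivity.HubbardSuperconductivity.Theorems.KLRegimeSplit

set_option linter.dupNamespace false -- summit = problem name (single-conjunct summit), D-0017

open Real Finset Literature.MathematicalPhysics.QuantumLattice Literature.Probability.LatticeModels
open Summit.HubbardSuperconductivity.HubbardSuperconductivity.Theorems.TwoPointAssembly

variable {L M : ℕ} {β : ℝ} (μ : ℝ) (K : TrigPolyC4v)

/-! ## §1 The rung times the localised linear form -/

/-- **`ĝ_K(p)·(iω_p − e_K(p)) = −1`** (`β ≠ 0`). -/
theorem klod_propCT_mul_lin (hβ : β ≠ 0) (p : FreqMomentum L M) :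
    propCT L M β μ K p * (Complex.I * (matsubaraFreq β M p.1 : ℂ) - (nambuXiCT L μ K p.2 : ℂ)) = -1 := by
  obtain ⟨h, h0⟩ := propCT_eq_one_div μ K hβ p
  rw [h, div_mul_eq_mul_div, one_mul, div_eq_iff h0]
  ring

/-- **Born-localised kernel identity**: `ĝ(p)²·(iω_p − e_K(p)) = −ĝ(p)`. -/
theorem klod_propCT_sq_mul_lin (hβ : β ≠ 0) (p : FreqMomentum L M) :
    propCT L M β μ K p ^ 2 * (Complex.I * (matsubaraFreq β M p.1 : ℂ) - (nambuXiCT L μ K p.2 : ℂ)) = -propCT L M β μ K p := by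
  rw [sq, mul_assoc, klod_propCT_mul_lin μ K hβ p, mul_neg_one]

/-! ## §2 Frequency reversal = complex conjugation -/

/-- **The rung at the reversed Matsubara label is the complex conjugate**: `ĝ_K(ν̄, k) = conj ĝ_K(ν, k)` (`ω_{ν̄} = −ω_ν`). -/
theorem klod_propCT_rev (ν : MatsubaraIdx M) (k : TorusSite 2 L) :
    propCT L M β μ K (ν.rev, k) = starRingEnd ℂ (propCT L M β μ K (ν, k)) := by
  simp only [propCT, matsubaraFreq_rev, one_div, map_inv₀, map_add, map_mul, map_neg, Complex.conj_I, Complex.conj_ofReal]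
  push_cast
  ring_nf

/-- The denominators: `ω_ν² + e_K(k)² > 0` (`β ≠ 0`: fermionic frequencies never vanish). -/
theorem klod_den_pos (hβ : β ≠ 0) (ν : MatsubaraIdx M) (k : TorusSite 2 L) :
    0 < matsubaraFreq β M ν ^ 2 + nambuXiCT L μ K k ^ 2 := by
  have hω : matsubaraFreq β M ν ≠ 0 := fun h => matsubaraFreq_ne_zero hβ ν h
  positivity

/-- **`ĝ(ν,k) + ĝ(ν̄,k) = 2·e_K(k)/(ω_ν² + e_K(k)²)`** — a real number. -/
theorem klod_propCT_add_rev (hβ : β ≠ 0) (ν : MatsubaraIdx M) (k : TorusSite 2 L) :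
    propCT L M β μ K (ν, k) + propCT L M β μ K (ν.rev, k) =
      ((2 * nambuXiCT L μ K k / (matsubaraFreq β M ν ^ 2 + nambuXiCT L μ K k ^ 2) : ℝ) : ℂ) := by
  have hω : matsubaraFreq β M ν ≠ 0 := fun h => matsubaraFreq_ne_zero hβ ν h
  have hd : ((matsubaraFreq β M ν : ℂ) ^ 2 + (nambuXiCT L μ K k : ℂ) ^ 2) ≠ 0 := by
    have h := (klod_den_pos μ K hβ ν k).ne'
    exact_mod_cast h
  have h10 : (-Complex.I * (matsubaraFreq β M ν : ℂ) + (nambuXiCT L μ K k : ℂ)) ≠ 0 :=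
    (propCT_eq_one_div μ K hβ ((ν, k) : FreqMomentum L M)).2
  have h20 : (Complex.I * (matsubaraFreq β M ν : ℂ) + (nambuXiCT L μ K k : ℂ)) ≠ 0 := by
    intro h
    have him := congrArg Complex.im h
    simp at him
    exact hω him
  simp only [propCT, matsubaraFreq_rev]
  push_cast
  have e1 : -Complex.I * -(matsubaraFreq β M ν : ℂ) + (nambuXiCT L μ K k : ℂ) = Complex.I * (matsubaraFreq β M ν : ℂ) + nambuXiCT L μ K k := by
    ring
  rw [e1, one_div_add_one_div h10 h20, div_eq_div_iff (mul_ne_zero h10 h20) hd]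
  ring_nf
  rw [Complex.I_sq]
  ring

/-! ## §3 Even frequency weights: the sum is real and carries the factor `e_K(k)` -/

/-- **MATSUBARA ODDNESS**: for an EVEN real weight `a(ν̄) = a(ν)`,
`Σ_ν a(ν)·ĝ_K(ν,k) = e_K(k)·Σ_ν a(ν)/(ω_ν² + e_K(k)²)` (in particular the sum is real and vanishes with `e_K(k)`). -/
theorem klod_sum_even_mul_propCT (hβ : β ≠ 0) (a : MatsubaraIdx M → ℝ) (ha : ∀ ν, a ν.rev = a ν) (k : TorusSite 2 L) :
    ∑ ν, (a ν : ℂ) * propCT L M β μ K (ν, k) =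
      ((nambuXiCT L μ K k * ∑ ν, a ν / (matsubaraFreq β M ν ^ 2 + nambuXiCT L μ K k ^ 2) : ℝ) : ℂ) := by
  -- re-index by the involution `ν ↦ ν̄`
  have hsum : ∑ ν, (a ν : ℂ) * propCT L M β μ K (ν.rev, k) = ∑ ν, (a ν : ℂ) * propCT L M β μ K (ν, k) :=
    Fintype.sum_equiv Fin.revPerm _ _ fun ν => by simp only [Fin.revPerm_apply, ha]
  have h2 : 2 * ∑ ν, (a ν : ℂ) * propCT L M β μ K (ν, k) =
      ∑ ν, (a ν : ℂ) * ((2 * nambuXiCT L μ K k / (matsubaraFreq β M ν ^ 2 + nambuXiCT L μ K k ^ 2) : ℝ) : ℂ) := by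
    rw [two_mul]
    nth_rewrite 2 [← hsum]
    rw [← sum_add_distrib]
    refine sum_congr rfl fun ν _ => ?_
    rw [← mul_add, klod_propCT_add_rev μ K hβ ν k]
  apply mul_left_cancel₀ (two_ne_zero : (2 : ℂ) ≠ 0)
  rw [h2]
  push_cast
  rw [mul_sum, mul_sum]
  refine sum_congr rfl fun ν _ => ?_
  ring

/-- **Real part and sign**: with a NONNEGATIVE even weight the real sum `Σ_ν a(ν)/(ω_ν² + e_K²)` is `≥ 0`, so `Σ_ν a(ν)·ĝ(ν,k)` has the sign of `e_K(k)`: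
`0 ≤ e_K(k) · Re Σ_ν a(ν)·ĝ(ν,k)`. -/
theorem klod_sum_even_mul_propCT_re_mul_xi_nonneg (hβ : β ≠ 0) (a : MatsubaraIdx M → ℝ) (ha : ∀ ν, a ν.rev = a ν) (ha0 : ∀ ν, 0 ≤ a ν)
    (k : TorusSite 2 L) :
    0 ≤ nambuXiCT L μ K k * (∑ ν, (a ν : ℂ) * propCT L M β μ K (ν, k)).re := by
  rw [klod_sum_even_mul_propCT μ K hβ a ha k, Complex.ofReal_re, ← mul_assoc]
  refine mul_nonneg (mul_self_nonneg _) (sum_nonneg fun ν _ => div_nonneg (ha0 ν) (klod_den_pos μ K hβ ν k).le)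

/-- The imaginary part vanishes. -/
theorem klod_sum_even_mul_propCT_im (hβ : β ≠ 0) (a : MatsubaraIdx M → ℝ) (ha : ∀ ν, a ν.rev = a ν) (k : TorusSite 2 L) :
    (∑ ν, (a ν : ℂ) * propCT L M β μ K (ν, k)).im = 0 := by
  rw [klod_sum_even_mul_propCT μ K hβ a ha k, Complex.ofReal_im]

/-- **The born-localised corollary**: `Σ_ν a(ν)·ĝ(ν,k)²·(iω_ν − e_K(k)) = −e_K(k)·Σ_ν a(ν)/(ω_ν² + e_K(k)²)` for an even weight `a`. -/
theorem klod_sum_even_mul_propCT_sq_mul_lin (hβ : β ≠ 0) (a : MatsubaraIdx M → ℝ) (ha : ∀ ν, a ν.rev = a ν) (k : TorusSite 2 L) :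
    ∑ ν, (a ν : ℂ) * (propCT L M β μ K (ν, k) ^ 2 * (Complex.I * (matsubaraFreq β M ν : ℂ) - (nambuXiCT L μ K k : ℂ))) =
      -(((nambuXiCT L μ K k * ∑ ν, a ν / (matsubaraFreq β M ν ^ 2 + nambuXiCT L μ K k ^ 2) : ℝ) : ℂ)) := by
  rw [← klod_sum_even_mul_propCT μ K hβ a ha k, ← sum_neg_distrib]
  refine sum_congr rfl fun ν _ => ?_
  rw [klod_propCT_sq_mul_lin μ K hβ ((ν, k) : FreqMomentum L M), mul_neg]

/-! ## §4 (appended) Odd frequency weights vanish on the symmetric Matsubara set — the parity behind the THERMAL twin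
(cure (C′) design §2 row 2: the band-flatness piece `zω·i(ω_i − ω₀)` of the localised self-energy keeps only `−ω₀ × (even sum)`, a `(π/β)/Λ`-sized term) -/

/-- **An ODD function of the Matsubara label sums to zero** over the symmetric fermionic set (`ν ↦ ν̄` is a fixed-point-free involution of the index set;
two-torsion-freeness of `ℂ`). -/
theorem klod_sum_odd_freq_eq_zero (b : MatsubaraIdx M → ℂ) (hb : ∀ ν, b ν.rev = -b ν) : ∑ ν, b ν = 0 := by
  have h : ∑ ν : MatsubaraIdx M, b (Fin.rev ν) = ∑ ν, b ν :=
    Fintype.sum_equiv Fin.revPerm (fun ν => b (Fin.rev ν)) b fun ν => by simp only [Fin.revPerm_apply]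
  have h2 : ∑ ν, b ν = -∑ ν, b ν := by
    rw [← sum_neg_distrib, ← h]
    exact sum_congr rfl fun ν _ => hb ν
  have h3 : (2 : ℂ) * ∑ ν, b ν = 0 := by rw [two_mul]; nth_rewrite 2 [h2]; exact add_neg_cancel _
  exact (mul_eq_zero.mp h3).resolve_left two_ne_zero

/-- **Band-restricted version**: the frequency band `{ω_ν² ≤ W}` is symmetric, so an odd `b` also sums to zero over it. -/
theorem klod_sum_odd_freq_band_eq_zero (b : MatsubaraIdx M → ℂ) (hb : ∀ ν, b ν.rev = -b ν) (W : ℝ) :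
    ∑ ν ∈ univ.filter (fun ν => matsubaraFreq β M ν ^ 2 ≤ W), b ν = 0 := by
  rw [sum_filter]
  refine klod_sum_odd_freq_eq_zero (fun ν => if matsubaraFreq β M ν ^ 2 ≤ W then b ν else 0) fun ν => ?_
  simp only [matsubaraFreq_rev, neg_sq, hb]
  split_ifs <;> simp

/-- **The thermal twin's parity**: for an EVEN real weight `a(ν̄) = a(ν)`, `Σ_{ω_ν² ≤ W} a(ν)·ω_ν = 0` — only the pinned `−ω₀·Σ a` part of
`Σ a(ν)·(ω_ν − ω₀)` survives, a `π/β`-sized (thermal-layer) quantity. -/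
theorem klod_sum_even_mul_freq_band_eq_zero (a : MatsubaraIdx M → ℝ) (ha : ∀ ν, a ν.rev = a ν) (W : ℝ) :
    ∑ ν ∈ univ.filter (fun ν => matsubaraFreq β M ν ^ 2 ≤ W), (a ν : ℂ) * (matsubaraFreq β M ν : ℂ) = 0 :=
  klod_sum_odd_freq_band_eq_zero (fun ν => (a ν : ℂ) * (matsubaraFreq β M ν : ℂ)) (fun ν => by
    simp only [ha, matsubaraFreq_rev]; push_cast; ring) W

/-- … hence `Σ_{ω_ν² ≤ W} a(ν)·(ω_ν − ω₀) = −ω₀·Σ_{ω_ν² ≤ W} a(ν)` for an even weight. -/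
theorem klod_sum_even_mul_freq_sub_band (a : MatsubaraIdx M → ℝ) (ha : ∀ ν, a ν.rev = a ν) (W ω₀ : ℝ) :
    ∑ ν ∈ univ.filter (fun ν => matsubaraFreq β M ν ^ 2 ≤ W), (a ν : ℂ) * ((matsubaraFreq β M ν : ℂ) - ω₀) =
      -(ω₀ : ℂ) * ∑ ν ∈ univ.filter (fun ν => matsubaraFreq β M ν ^ 2 ≤ W), (a ν : ℂ) := by
  simp only [mul_sub, sum_sub_distrib, klod_sum_even_mul_freq_band_eq_zero a ha W, zero_sub, mul_sum, neg_mul]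
  rw [← sum_neg_distrib]
  exact sum_congr rfl fun ν _ => by ring

/-! ## §5 (appended) The DOUBLE rung `ĝ²` against an even weight, and the general localised linear form `zω·iω + ze·e_K`
(cure (C′) design §2 row 1 with TWO coefficients: `zω·iω + ze·e = zω·(iω − e) + (zω + ze)·e`, so the born kernel sees `−zω·ĝ + (zω + ze)·e·ĝ²` —
both pieces are `e_K ×` an even function of `e_K` after the frequency sum, i.e. ODD momentum sums for the layer/asymmetry bricks O2/O3) -/

/-- **`ĝ(ν,k)² + ĝ(ν̄,k)² = 2·(e_K² − ω_ν²)/(ω_ν² + e_K²)²`** — a real number, EVEN in `e_K(k)`. -/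
theorem klod_propCT_sq_add_rev (hβ : β ≠ 0) (ν : MatsubaraIdx M) (k : TorusSite 2 L) :
    propCT L M β μ K (ν, k) ^ 2 + propCT L M β μ K (ν.rev, k) ^ 2 =
      ((2 * (nambuXiCT L μ K k ^ 2 - matsubaraFreq β M ν ^ 2) / (matsubaraFreq β M ν ^ 2 + nambuXiCT L μ K k ^ 2) ^ 2 : ℝ) : ℂ) := by
  have hω : matsubaraFreq β M ν ≠ 0 := fun h => matsubaraFreq_ne_zero hβ ν h
  have hd : ((matsubaraFreq β M ν : ℂ) ^ 2 + (nambuXiCT L μ K k : ℂ) ^ 2) ≠ 0 := by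
    have h := (klod_den_pos μ K hβ ν k).ne'
    exact_mod_cast h
  have h10 : (-Complex.I * (matsubaraFreq β M ν : ℂ) + (nambuXiCT L μ K k : ℂ)) ≠ 0 :=
    (propCT_eq_one_div μ K hβ ((ν, k) : FreqMomentum L M)).2
  have h20 : (Complex.I * (matsubaraFreq β M ν : ℂ) + (nambuXiCT L μ K k : ℂ)) ≠ 0 := by
    intro h
    have him := congrArg Complex.im h
    simp at him
    exact hω him
  have hprod : (-Complex.I * (matsubaraFreq β M ν : ℂ) + (nambuXiCT L μ K k : ℂ)) * (Complex.I * (matsubaraFreq β M ν : ℂ) + nambuXiCT L μ K k) =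
      (matsubaraFreq β M ν : ℂ) ^ 2 + (nambuXiCT L μ K k : ℂ) ^ 2 := by
    ring_nf; rw [Complex.I_sq]; ring
  simp only [propCT, matsubaraFreq_rev]
  push_cast
  have e1 : -Complex.I * -(matsubaraFreq β M ν : ℂ) + (nambuXiCT L μ K k : ℂ) = Complex.I * (matsubaraFreq β M ν : ℂ) + nambuXiCT L μ K k := by
    ring
  rw [e1, one_div, one_div, inv_pow, inv_pow, inv_add_inv (pow_ne_zero 2 h10) (pow_ne_zero 2 h20), ← mul_pow, hprod,
    div_eq_div_iff (pow_ne_zero 2 hd) (pow_ne_zero 2 hd)]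
  ring_nf
  rw [Complex.I_sq]
  ring

/-- **Even weight against the DOUBLE rung**: `Σ_ν a(ν)·ĝ(ν,k)² = Σ_ν a(ν)·(e_K² − ω_ν²)/(ω_ν² + e_K²)²` — REAL and EVEN in `e_K(k)`. -/
theorem klod_sum_even_mul_propCT_sq (hβ : β ≠ 0) (a : MatsubaraIdx M → ℝ) (ha : ∀ ν, a ν.rev = a ν) (k : TorusSite 2 L) :
    ∑ ν, (a ν : ℂ) * propCT L M β μ K (ν, k) ^ 2 =
      ((∑ ν, a ν * (nambuXiCT L μ K k ^ 2 - matsubaraFreq β M ν ^ 2) / (matsubaraFreq β M ν ^ 2 + nambuXiCT L μ K k ^ 2) ^ 2 : ℝ) : ℂ) := by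
  have hsum : ∑ ν, (a ν : ℂ) * propCT L M β μ K (ν.rev, k) ^ 2 = ∑ ν, (a ν : ℂ) * propCT L M β μ K (ν, k) ^ 2 :=
    Fintype.sum_equiv Fin.revPerm _ _ fun ν => by simp only [Fin.revPerm_apply, ha]
  have h2 : 2 * ∑ ν, (a ν : ℂ) * propCT L M β μ K (ν, k) ^ 2 =
      ∑ ν, (a ν : ℂ) * ((2 * (nambuXiCT L μ K k ^ 2 - matsubaraFreq β M ν ^ 2) / (matsubaraFreq β M ν ^ 2 + nambuXiCT L μ K k ^ 2) ^ 2 : ℝ) : ℂ) := by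
    rw [two_mul]
    nth_rewrite 2 [← hsum]
    rw [← sum_add_distrib]
    refine sum_congr rfl fun ν _ => ?_
    rw [← mul_add, klod_propCT_sq_add_rev μ K hβ ν k]
  apply mul_left_cancel₀ (two_ne_zero : (2 : ℂ) ≠ 0)
  rw [h2]
  push_cast
  rw [mul_sum]
  refine sum_congr rfl fun ν _ => ?_
  ring

/-- **The born kernel against the general localised linear form**: `ĝ(p)²·(zω·iω_p + ze·e_K(p)) = −zω·ĝ(p) + (zω + ze)·e_K(p)·ĝ(p)²`
(`zω·iω + ze·e = zω·(iω − e) + (zω + ze)·e` and `ĝ²·(iω − e) = −ĝ`). -/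
theorem klod_propCT_sq_mul_linForm (hβ : β ≠ 0) (zω ze : ℂ) (p : FreqMomentum L M) :
    propCT L M β μ K p ^ 2 * (zω * (Complex.I * (matsubaraFreq β M p.1 : ℂ)) + ze * (nambuXiCT L μ K p.2 : ℂ)) =
      -zω * propCT L M β μ K p + (zω + ze) * (nambuXiCT L μ K p.2 : ℂ) * propCT L M β μ K p ^ 2 := by
  have h := klod_propCT_sq_mul_lin μ K hβ p
  have e : zω * (Complex.I * (matsubaraFreq β M p.1 : ℂ)) + ze * (nambuXiCT L μ K p.2 : ℂ) =
      zω * (Complex.I * (matsubaraFreq β M p.1 : ℂ) - (nambuXiCT L μ K p.2 : ℂ)) + (zω + ze) * (nambuXiCT L μ K p.2 : ℂ) := by ring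
  rw [e, mul_add, ← mul_assoc, mul_comm (propCT L M β μ K p ^ 2) zω, mul_assoc, h]
  ring

/-- **THE LOCALISED BORN FREQUENCY SUM IS `e_K ×` (EVEN IN `e_K`)**: for an even real weight `a(ν̄) = a(ν)` and coefficients `zω, ze`,
`Σ_ν a(ν)·ĝ(ν,k)²·(zω·iω_ν + ze·e_K(k)) = e_K(k)·(−zω·Σ_ν a(ν)/(ω_ν² + e_K²) + (zω + ze)·Σ_ν a(ν)(e_K² − ω_ν²)/(ω_ν² + e_K²)²)` —
with `a` depending on `k` through `e_K(k)²` only (all cutoff / slice / soft symbols of the tree), an ODD function of the level `e_K(k)`: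
the input shape of the layer brick O2 (`klol_abs_sum_odd_le`) and the GEO brick O3. [cite: BenfattoGiulianiMastropietro2006, §2.9] -/
theorem klod_sum_even_mul_propCT_sq_mul_linForm (hβ : β ≠ 0) (a : MatsubaraIdx M → ℝ) (ha : ∀ ν, a ν.rev = a ν) (zω ze : ℂ)
    (k : TorusSite 2 L) :
    ∑ ν, (a ν : ℂ) * (propCT L M β μ K (ν, k) ^ 2 * (zω * (Complex.I * (matsubaraFreq β M ν : ℂ)) + ze * (nambuXiCT L μ K k : ℂ))) =
      (nambuXiCT L μ K k : ℂ) *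
        (-zω * ((∑ ν, a ν / (matsubaraFreq β M ν ^ 2 + nambuXiCT L μ K k ^ 2) : ℝ) : ℂ) +
          (zω + ze) * ((∑ ν, a ν * (nambuXiCT L μ K k ^ 2 - matsubaraFreq β M ν ^ 2) /
            (matsubaraFreq β M ν ^ 2 + nambuXiCT L μ K k ^ 2) ^ 2 : ℝ) : ℂ)) := by
  have h1 := klod_sum_even_mul_propCT μ K hβ a ha k
  have h2 := klod_sum_even_mul_propCT_sq μ K hβ a ha k
  have hterm : ∀ ν, (a ν : ℂ) * (propCT L M β μ K (ν, k) ^ 2 * (zω * (Complex.I * (matsubaraFreq β M ν : ℂ)) + ze * (nambuXiCT L μ K k : ℂ))) =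
      -zω * ((a ν : ℂ) * propCT L M β μ K (ν, k)) + (zω + ze) * (nambuXiCT L μ K k : ℂ) * ((a ν : ℂ) * propCT L M β μ K (ν, k) ^ 2) := by
    intro ν
    rw [klod_propCT_sq_mul_linForm μ K hβ zω ze ((ν, k) : FreqMomentum L M)]
    ring
  rw [sum_congr rfl fun ν _ => hterm ν, sum_add_distrib, ← mul_sum, ← mul_sum, h1, h2]
  push_cast
  ring

end Summit.HubbardSuperconductivity.HubbardSuperconductivity.Theorems.KLRegimeSplit

end
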